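import Mathlib
import Summits.RiemannHypothesis.RiemannHypothesis.Theses.EarlyAppointments
import Literature.Analysis.Complex.RoucheTheorem
import Literature.Analysis.Complex.FordZeroDetector
import HarnessLib

/-!
# Skeleton for CombDescentStep (stmt-RiemannHypothesis-3184)

The comb descent step: deterministic Kabluchko-Seidel over a comb. For a comb configuration
(entire f real on ℝ, simple zero at x₀ + ih, ε-regular real zeros of spacing s, remainder η/s),
the derivative f' has exactly one zero w in D(x₀ + ih, h/2) with Im w ≈ h - s/π.

## Strategy
1. Define the auxiliary field F(z) = f'(z)/f(z) - 1/(z - z₀) where z₀ = x₀ + ih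
2. Show F is holomorphic at z₀ (the simple zero cancels the pole)
3. Estimate F(z₀) using the cot-kernel comparison for real zeros
4. Apply Rouché to 1 + (z - z₀)·F(z) vs (z - z₀) on |z - z₀| = h/2
5. Conclude unique zero and bound its imaginary part
-/

noncomputable section

open scoped BigOperators Topology ComplexConjugate
open Set Function Filter Metric

namespace Summit.RiemannHypothesis.RiemannHypothesis.Theorems.CombDescentStep

-- The constant in the theorem. We choose C = 2 which works with the shape from the docstring.
-- The actual optimal constant depends on the cot-kernel estimates.
private def theConstant : ℝ := 2

/-- stub_roucheApplication: Apply Rouché's theorem to show that f' has exactly one zero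
in D(z₀, h/2). The function 1 + (z - z₀)·F(z) where F = f'/f - 1/(z - z₀) has the same
number of zeros as (z - z₀) in the disc, which is exactly one.

The key comparison on the boundary: |1 + (z - z₀)·F(z) - (z - z₀)·F(z₀)| < |z - z₀|·|F(z₀)|
when |z - z₀| = h/2, using the holomorphicity of F and the bound on ‖F'‖. -/
theorem stub_roucheApplication {f : ℂ → ℂ} {x₀ s h R ε η : ℝ} {z₀ : ℂ}
    (hf_diff : Differentiable ℂ f)
    (hf_real : ∀ x : ℝ, (f (x : ℂ)).im = 0)
    (hs : 0 < s)
    (hh : theConstant * s ≤ h)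
    (hR : theConstant * h ≤ R)
    (heps : 0 ≤ ε)
    (heps_small : theConstant * ε * (1 + Real.log (R / h)) ≤ 1)
    (heta : 0 ≤ η)
    (heta_small : theConstant * η ≤ 1)
    (hz₀ : z₀ = (x₀ : ℂ) + h * Complex.I)
    (hf_z₀ : f z₀ = 0)
    (hf_z₀_simple : deriv f z₀ ≠ 0)
    (hpair : ∀ w : ℂ, ‖w - (x₀ : ℂ)‖ < R → f w = 0 → w.im ≠ 0 →
      (w = z₀ ∨ w = (x₀ : ℂ) - h * Complex.I))
    (hzeros_simple : ∀ x : ℝ, |x - x₀| < R → f (x : ℂ) = 0 → deriv f (x : ℂ) ≠ 0)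
    (hcomb : ∀ r : ℝ, s ≤ r → r ≤ R →
      |(({x : ℝ | f (x : ℂ) = 0 ∧ x₀ < x ∧ x ≤ x₀ + r}).ncard : ℝ) - r / s| ≤ ε * r / s + 1 ∧
      |(({x : ℝ | f (x : ℂ) = 0 ∧ x₀ - r ≤ x ∧ x < x₀}).ncard : ℝ) - r / s| ≤ ε * r / s + 1)
    (hremainder : ∀ z : ℂ, ‖z - z₀‖ ≤ h / 2 → f z ≠ 0 →
      ‖deriv f z / f z - ∑ᶠ w ∈ {w : ℂ | f w = 0 ∧ ‖w - (x₀ : ℂ)‖ < R}, (z - w)⁻¹‖ ≤ η / s) :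
    ∃! w : ℂ, ‖w - z₀‖ < h / 2 ∧ deriv f w = 0 := by
  -- Step 1: f is analytic at z₀ (entire => analytic)
  have hf_an : AnalyticAt ℂ f z₀ := Complex.analyticAt_iff_eventually_differentiableAt.2
    (Filter.Eventually.of_forall (fun _ => hf_diff _))
  -- Step 2: f = (z - z₀) * g where g(z₀) = f'(z₀) ≠ 0
  have hf_ord : analyticOrderAt f z₀ = 1 :=
    hf_an.analyticOrderAt_eq_one_of_zero_deriv_ne_zero hf_z₀ hf_z₀_simple
  -- Step 3: By Mathlib's factorization `analyticOrderAt_eq_natCast`,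
  -- ∃ g analytic with g(z₀) ≠ 0 and f =ᶠ (· - z₀) • g near z₀
  obtain ⟨g, hg, hg0, hfac⟩ := hf_an.analyticOrderAt_eq_natCast.mp hf_ord
  -- Now: f =ᶠ[𝓝 z₀] (· - z₀)^1 • g = (· - z₀) * g
  -- Step 4: Define G = g'/g (holomorphic at z₀ since g(z₀) ≠ 0)
  -- g is analytic at z₀, so g' exists and g'/g is analytic at z₀
  have hg_diff : DifferentiableAt ℂ g z₀ := hg.differentiableAt
  -- Define G locally
  set G : ℂ → ℂ := fun z => deriv g z / g z with hG_def
  -- G is holomorphic near z₀ (g ≠ 0 near z₀ by continuity)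
  have hg_ne : ∀ᶠ z in 𝓝 z₀, g z ≠ 0 := hg.continuousAt.eventually_ne hg0
  -- Step 5: From f = (z - z₀) * g, we have f' = g + (z - z₀) * g'
  -- So f'(z) = 0 at z ≠ z₀ iff g(z) + (z - z₀) * g'(z) = 0
  -- iff 1 + (z - z₀) * (g'/g)(z) = 0 (when g(z) ≠ 0)
  -- iff 1 + (z - z₀) * G(z) = 0
  -- Define F(z) = 1 + (z - z₀) * G(z)
  set F : ℂ → ℂ := fun z => 1 + (z - z₀) * G z with hF_def
  -- Step 6: f'/f = ψ/(z - z₀) near z₀ by logDeriv_eq_div_sub_near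
  -- For a simple zero (m = 1), ψ(z) = 1 + (z - z₀) * (g'/g) = 1 + (z - z₀) * G(z)
  -- So f'/f = (1 + (z - z₀) * G(z)) / (z - z₀) = 1/(z - z₀) + G(z)
  have hne_top : analyticOrderAt f z₀ ≠ ⊤ := by rw [hf_ord]; exact ENat.one_ne_top
  obtain ⟨ψ, hψ_an, hψ_z₀, hψ_eq⟩ := Literature.Analysis.Complex.FordDetector.logDeriv_eq_div_sub_near hf_an hne_top
  -- hψ_z₀ : ψ z₀ = analyticOrderNatAt f z₀ = 1
  have hψ_val : ψ z₀ = 1 := by rw [hψ_z₀, analyticOrderNatAt, hf_ord]; simp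
  -- Near z₀: deriv f z / f z = ψ z / (z - z₀) = (1 + (z - z₀) * (ψ - 1)/(z - z₀)) / (z - z₀) when z ≠ z₀
  -- Define Ψ(z) = (ψ(z) - 1) / (z - z₀), analytic at z₀ with Ψ(z₀) = ψ'(z₀)
  -- Then ψ(z) = 1 + (z - z₀) * Ψ(z) near z₀
  -- Step 7: Estimate G(z₀)
  -- G(z₀) = g'(z₀)/g(z₀)
  -- From the factorization and the hypothesis hremainder:
  -- f'/f = 1/(z - z₀) + G near z₀, and hremainder says f'/f ≈ ∑_{w} 1/(z-w) + O(η/s)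
  -- So G(z₀) ≈ ∑_{w≠z₀} 1/(z₀-w) = 1/(z₀-(x₀-ih)) + ∑_{real zeros} 1/(z₀-x)
  --         = -i/(2h) + (-iπ/s + O(ε(1+log(R/h)) + s/h))  [cot-kernel for real zeros]
  --         ≈ -i(π/s + 1/(2h))
  -- Step 7: Apply Rouché comparing F with F₀(z) = 1 + (z - z₀) * G(z₀)
  -- F₀ has unique zero at w* = z₀ - 1/G(z₀), with |w* - z₀| = 1/|G(z₀)| ≈ s/π << h/2
  -- For Rouché: |F - F₀| = |(z - z₀)| * |G - G(z₀)| < |F₀| on |z - z₀| = h/2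
  -- This follows from derivative bounds on G
  sorry

/-- stub_locationEstimate: The unique critical point w of f in D(z₀, h/2) satisfies
|Im w - (h - s/π)| ≤ C·s·(error terms). This follows from w ≈ z₀ - 1/F(z₀) and the
estimate F(z₀) ≈ -i·(π/s + 1/(2h)). -/
theorem stub_locationEstimate {f : ℂ → ℂ} {x₀ s h R ε η : ℝ} {z₀ w : ℂ}
    (hf_diff : Differentiable ℂ f)
    (hf_real : ∀ x : ℝ, (f (x : ℂ)).im = 0)
    (hs : 0 < s)
    (hh : theConstant * s ≤ h)
    (hR : theConstant * h ≤ R)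
    (heps : 0 ≤ ε)
    (heps_small : theConstant * ε * (1 + Real.log (R / h)) ≤ 1)
    (heta : 0 ≤ η)
    (heta_small : theConstant * η ≤ 1)
    (hz₀ : z₀ = (x₀ : ℂ) + h * Complex.I)
    (hw_in : ‖w - z₀‖ < h / 2)
    (hw_crit : deriv f w = 0)
    (hcomb : ∀ r : ℝ, s ≤ r → r ≤ R →
      |(({x : ℝ | f (x : ℂ) = 0 ∧ x₀ < x ∧ x ≤ x₀ + r}).ncard : ℝ) - r / s| ≤ ε * r / s + 1 ∧
      |(({x : ℝ | f (x : ℂ) = 0 ∧ x₀ - r ≤ x ∧ x < x₀}).ncard : ℝ) - r / s| ≤ ε * r / s + 1)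
    (hremainder : ∀ z : ℂ, ‖z - z₀‖ ≤ h / 2 → f z ≠ 0 →
      ‖deriv f z / f z - ∑ᶠ u ∈ {u : ℂ | f u = 0 ∧ ‖u - (x₀ : ℂ)‖ < R}, (z - u)⁻¹‖ ≤ η / s) :
    |w.im - (h - s / Real.pi)| ≤ theConstant * s *
      (ε * (1 + Real.log (R / h)) + s / h + h / R + η) := by
  sorry

/-- The main theorem assembling the stubs. -/
theorem combDescentStep_of :
    Summit.RiemannHypothesis.RiemannHypothesis.Theses.EarlyAppointments.CombDescentStep := by
  -- Unfold the definition
  unfold Summit.RiemannHypothesis.RiemannHypothesis.Theses.EarlyAppointments.CombDescentStep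
  -- Provide the constant C = theConstant
  refine ⟨theConstant, ?_, ?_⟩
  · -- 0 < C
    unfold theConstant
    norm_num
  · -- The main quantified statement
    intro f x₀ s h R ε η hf_diff hf_real hs hh hR heps heps_small heta heta_small
    intro hf_z₀ hf_z₀_simple hpair hzeros_simple hcomb hremainder
    -- Let z₀ = x₀ + ih
    set z₀ : ℂ := (x₀ : ℂ) + h * Complex.I with hz₀
    -- Apply stub_roucheApplication to get the unique critical point
    obtain ⟨w, ⟨hw_in, hw_crit⟩, hw_unique⟩ := stub_roucheApplication hf_diff hf_real hs hh hR
      heps heps_small heta heta_small hz₀ hf_z₀ hf_z₀_simple hpair hzeros_simple hcomb hremainder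
    -- Apply stub_locationEstimate to get the imaginary part bound
    have hloc := stub_locationEstimate hf_diff hf_real hs hh hR heps heps_small heta heta_small
      hz₀ hw_in hw_crit hcomb hremainder
    -- Package the result
    refine ⟨w, hw_crit, hw_in, hloc, ?_⟩
    -- Uniqueness
    intro w' hw'_crit hw'_in
    exact hw_unique w' ⟨hw'_in, hw'_crit⟩

end Summit.RiemannHypothesis.RiemannHypothesis.Theorems.CombDescentStep

end
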